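import Mathlib

/-!
# Tool stub `stub_sliceIntegral` of the line `Sketch`
# (crux `DyadicWallCascade.HalfSpaceHierarchy`, item stmt-AnomalousDissipation-18627)

Sorry-free discharge of the registered tool stub `stub_sliceIntegral` of the lead's skeleton
`Cruxes/HalfSpaceHierarchy/Lines/Sketch.lean` (negative side, 2½-D no-go "no witness of the crux is
independent of `x`").

**Statement (flux integrals of `x`-independent integrands are slice integrals).**  Let
`g : ℝ × ℝ → ℝ` be continuous with `g (x, y) = g (0, y)` for all `(x, y)`.  Then the Bochner set
integral of `g` over the flux square `[0,1] × [0,1]` (w.r.t. Lebesgue `volume` on `ℝ × ℝ`) equals the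
one-dimensional interval integral of the slice: `∫_{[0,1]²} g = ∫₀¹ g (0, y) dy`.

In the crux the mass flux `∫_{[0,1]²} V₃(x, y, 1)` and the head flux
`∫_{[0,1]²} V₃ (‖V‖² / 2 + Q)(x, y, 1)` are such set integrals; when `V, Q` do not depend on `x` this
lemma converts them into the interval integrals used by the planar (stream-function) argument.

**Proof.**  Replace the integrand by `q ↦ 1 · G q.2` with `G y = g (0, y)` (pointwise equal by
hypothesis, `setIntegral_congr_fun`).  Lebesgue measure on `ℝ × ℝ` is the product measure
(`Measure.volume_eq_prod`), so Fubini for products of one-variable functions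
(`setIntegral_prod_mul`, no integrability hypothesis needed) gives
`∫_{[0,1]²} 1 · G(q.2) dq = (∫_{[0,1]} 1 dx) · ∫_{[0,1]} G(y) dy = 1 · ∫_{[0,1]} G`, using
`vol [0,1] = 1` (`Real.volume_real_Icc_of_le`).  Finally `∫_{Icc 0 1} G = ∫_{Ioc 0 1} G = ∫₀¹ G`
(`integral_Icc_eq_integral_Ioc`, `intervalIntegral.integral_of_le`).  Continuity of `g` is part of
the registered signature but is not needed by this route.

Source: folklore (Fubini on a rectangle).  No named facts and no tree imports are used.
-/

set_option linter.dupNamespace false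

open Set MeasureTheory

namespace Summit.AnomalousDissipation.AnomalousDissipation.Theorems.HalfSpaceHierarchy

/-- **Slice integral.**  For a continuous `g : ℝ × ℝ → ℝ` that does not depend on the first
variable, `g (x, y) = g (0, y)`, the set integral over the unit square `[0,1] × [0,1]` equals the
interval integral of the slice, `∫_{[0,1]²} g = ∫₀¹ g (0, y) dy` (Fubini on the unit square; the
continuity hypothesis is not used). [folklore] -/
theorem stub_sliceIntegral :
    ∀ (g : ℝ × ℝ → ℝ), Continuous g → (∀ q : ℝ × ℝ, g q = g (0, q.2)) →
      ∫ q in Set.Icc (0 : ℝ) 1 ×ˢ Set.Icc (0 : ℝ) 1, g q = ∫ y in (0 : ℝ)..1, g (0, y) := by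
  intro g _hg hx
  -- Fubini for the product integrand `1 * G q.2`, `G y = g (0, y)`, on `[0,1] × [0,1]`
  have key := setIntegral_prod_mul (μ := (volume : Measure ℝ)) (ν := (volume : Measure ℝ))
    (fun _ : ℝ => (1 : ℝ)) (fun y : ℝ => g (0, y)) (Set.Icc (0 : ℝ) 1) (Set.Icc (0 : ℝ) 1)
  rw [← Measure.volume_eq_prod, setIntegral_const, smul_eq_mul, mul_one,
    Real.volume_real_Icc_of_le zero_le_one, sub_zero, one_mul] at key
  simp only [one_mul] at key
  -- `key : ∫ q in [0,1]², g (0, q.2) = ∫ y in Icc 0 1, g (0, y)`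
  rw [intervalIntegral.integral_of_le zero_le_one, ← integral_Icc_eq_integral_Ioc, ← key]
  exact setIntegral_congr_fun (measurableSet_Icc.prod measurableSet_Icc) fun q _ => hx q

end Summit.AnomalousDissipation.AnomalousDissipation.Theorems.HalfSpaceHierarchy
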